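import Literature.Probability.RandomPlanarGeometry.HexSAWObservable
import Mathlib.Analysis.SpecialFunctions.Complex.Arg
import HarnessLib

/-!
# A discrete Hopf Umlaufsatz for open polygonal paths, and the geometry of the embedded honeycomb

Topic `Literature/Probability/RandomPlanarGeometry`; support file for the discharge of the named
facts `Literature.Probability.RandomPlanarGeometry.SAW.DuminilCopinSmirnov2012_lemma2`
(`HexSAWStrip.lean`) and `…DuminilCopinSmirnov2012_thm1` (`HexSAW.lean`). Source: H. Duminil-Copin,
S. Smirnov, *The connective constant of the honeycomb lattice equals `√(2+√2)`*, Ann. of Math.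
175 (2012), 1653–1665 (arXiv:1007.0575). In the proof of Lemma 2 (p. 5) the windings of the
self-avoiding walks from `a` to the four parts of the boundary of the strip `S_{T,L}` are
evaluated: "the winding of any self-avoiding walk from `a` to the bottom part of `α` is `-π`
while the winding to the top part is `π` … the winding from `a` to any half-edge in `β` (resp.
`ε` and `ε̄`) is `0` (resp. `2π/3` and `-2π/3`)". This is a topological statement about simple
polygonal paths joining two extreme points; we prove it through a discrete version of H. Hopf's
proof of the Umlaufsatz (Hopf, *Über die Drehung der Tangenten und Sehnen ebener Kurven*,
Compositio Math. 2 (1935); the tangent map of a simple curve is deformed through secant maps).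

## Contents

* Namespace `Literature.Probability.RandomPlanarGeometry.SAW.Hopf` (plain complex geometry):
  lifting identities in `Real.Angle = ℝ/2πℤ` to real numbers when all angles are `< π/2`
  (`toReal_add_of_lt`, `toReal_add_eq_toReal_add`), the angle between two vectors with positive
  inner product (`abs_toReal_argDiff_lt`), swept angles inside a closed half-plane
  (`sum_toReal_argDiff_eq`), and **`hopf_open`**: for points `q₀, …, q_{m+1}` such that every
  segment `[q_k, q_{k+1}]` is seen from every other `q_j` under an angle `< π/2`, the total
  turning `Σ ∡(q_{j+1} - q_j, q_{j+2} - q_{j+1})` equals the angle swept by the secant into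
  `q_{m+1}` plus the angle swept by the secant from `q₀` (every elementary quadrilateral /
  triangle of secant directions has zero circulation).
* Namespace `…SAW.HV` (the coordinate model, embedding `emb ∘ pos` of `HexSAWObservable`):
  `emb_re`, `emb_im`, `emb_injective`, the inner product of embedded lattice vectors through
  Eisenstein norms `a² + ab + b²` (`emb_mul_conj_re`), the minimal distance of the lattice
  (`three_le_enorm_pos_sub`), and **`subtended_pos`**: an edge of `ℍ` is seen from any third
  vertex under an angle `< π/2` — the hypothesis of `hopf_open` for self-avoiding lattice paths.

The application to walks (`HexSAWHopfPath.lean`, `HexSAWBoundaryWinding.lean`) and Lemma 2 /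
Theorem 1 (`HexSAWLemma2.lean`) follow.
-/

noncomputable section

open Finset

namespace Literature.Probability.RandomPlanarGeometry.SAW

namespace Hopf

open Real

/-! ### Lifting identities of angles to real numbers -/

/-- A real number that vanishes modulo `2π` and is smaller than `2π` in absolute value is `0`.
[folklore] -/
theorem eq_zero_of_coe_angle_eq_zero {x : ℝ} (hx : (x : Angle) = 0) (habs : |x| < 2 * π) :
    x = 0 := by
  obtain ⟨k, hk⟩ := Angle.angle_eq_iff_two_pi_dvd_sub.1 (hx.trans Angle.coe_zero.symm)
  rw [sub_zero] at hk
  rw [hk, abs_lt] at habs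
  have h1 : (-1 : ℝ) < k := by
    by_contra h; push Not at h; nlinarith [Real.pi_pos]
  have h2 : (k : ℝ) < 1 := by
    by_contra h; push Not at h; nlinarith [Real.pi_pos]
  have : k = 0 := by
    have h1' : (-1 : ℤ) < k := by exact_mod_cast h1
    have h2' : k < (1 : ℤ) := by exact_mod_cast h2
    omega
  rw [hk, this]; simp

/-- `toReal` is additive on two angles of absolute value `< π/2`. [folklore] -/
theorem toReal_add_of_lt {α β : Angle} (hα : |α.toReal| < π / 2) (hβ : |β.toReal| < π / 2) :
    (α + β).toReal = α.toReal + β.toReal := by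
  have h : ((α.toReal + β.toReal : ℝ) : Angle) = α + β := by
    rw [Angle.coe_add, Angle.coe_toReal, Angle.coe_toReal]
  rw [← h, Angle.toReal_coe_eq_self_iff]
  rw [abs_lt] at hα hβ
  constructor <;> linarith

/-- If an angle `γ` is the sum of two angles of absolute value `< π/2`, its `toReal` is the sum of
theirs. [folklore] -/
theorem toReal_eq_add_of_lt {α β γ : Angle} (h : α + β = γ) (hα : |α.toReal| < π / 2)
    (hβ : |β.toReal| < π / 2) : γ.toReal = α.toReal + β.toReal := by
  rw [← h, toReal_add_of_lt hα hβ]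

/-- Four angles summing to zero, each of absolute value `< π/2`, have real representatives
summing to zero (the plaquette lemma of the discrete Hopf argument). [folklore] -/
theorem toReal_sum4_eq_zero {α β γ δ : Angle} (h : α + β + γ + δ = 0) (hα : |α.toReal| < π / 2)
    (hβ : |β.toReal| < π / 2) (hγ : |γ.toReal| < π / 2) (hδ : |δ.toReal| < π / 2) :
    α.toReal + β.toReal + γ.toReal + δ.toReal = 0 := by
  apply eq_zero_of_coe_angle_eq_zero
  · rw [Angle.coe_add, Angle.coe_add, Angle.coe_add, Angle.coe_toReal, Angle.coe_toReal,
      Angle.coe_toReal, Angle.coe_toReal, h]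
  · rw [abs_lt] at hα hβ hγ hδ ⊢
    constructor <;> linarith

/-- Two pairs of angles with equal sums, each of absolute value `< π/2`, have equal real sums.
[folklore] -/
theorem toReal_add_eq_toReal_add {α β γ δ : Angle} (h : α + β = γ + δ) (hα : |α.toReal| < π / 2)
    (hβ : |β.toReal| < π / 2) (hγ : |γ.toReal| < π / 2) (hδ : |δ.toReal| < π / 2) :
    α.toReal + β.toReal = γ.toReal + δ.toReal := by
  rw [← toReal_add_of_lt hα hβ, ← toReal_add_of_lt hγ hδ, h]

/-! ### Angles between complex numbers

The angle from `w` to `v` is the difference `↑(arg v) - ↑(arg w)` in `Real.Angle`; its principal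
value is `(↑(arg v) - ↑(arg w)).toReal ∈ (-π, π]`. -/

/-- Angle differences telescope. [folklore] -/
theorem argDiff_add_argDiff (u v w : ℂ) :
    ((Complex.arg u : Angle) - (Complex.arg v : Angle)) +
        ((Complex.arg v : Angle) - (Complex.arg w : Angle)) =
      (Complex.arg u : Angle) - (Complex.arg w : Angle) := by
  abel

/-- The angle from `w` to `v` is the argument of `v / w`. [folklore] -/
theorem argDiff_eq_arg_div {v w : ℂ} (hv : v ≠ 0) (hw : w ≠ 0) :
    (Complex.arg v : Angle) - (Complex.arg w : Angle) = (Complex.arg (v / w) : Angle) := by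
  rw [Complex.arg_div_coe_angle hv hw]

/-- The angle between two nonzero vectors is invariant under negating both. [folklore] -/
theorem argDiff_neg_neg {v w : ℂ} (hv : v ≠ 0) (hw : w ≠ 0) :
    (Complex.arg (-v) : Angle) - (Complex.arg (-w) : Angle) =
      (Complex.arg v : Angle) - (Complex.arg w : Angle) := by
  rw [Complex.arg_neg_coe_angle hv, Complex.arg_neg_coe_angle hw]; abel

/-- The angle between two nonzero vectors is invariant under a common nonzero scalar factor.
[folklore] -/
theorem argDiff_mul_mul {c : ℂ} (hc : c ≠ 0) {v w : ℂ} (hv : v ≠ 0) (hw : w ≠ 0) :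
    (Complex.arg (c * v) : Angle) - (Complex.arg (c * w) : Angle) =
      (Complex.arg v : Angle) - (Complex.arg w : Angle) := by
  rw [Complex.arg_mul_coe_angle hc hv, Complex.arg_mul_coe_angle hc hw]; abel

/-- If `⟨v, w⟩ > 0` then the angle from `w` to `v` is less than `π/2` in absolute value.
[folklore] -/
theorem abs_toReal_argDiff_lt {v w : ℂ} (h : 0 < (v * (starRingEnd ℂ) w).re) :
    |((Complex.arg v : Angle) - (Complex.arg w : Angle)).toReal| < π / 2 := by
  have hv : v ≠ 0 := by rintro rfl; simp at h
  have hw : w ≠ 0 := by rintro rfl; simp at h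
  rw [argDiff_eq_arg_div hv hw, Complex.arg_coe_angle_toReal_eq_arg,
    Complex.abs_arg_lt_pi_div_two_iff]
  left
  have e : v / w = v * (starRingEnd ℂ) w * ((Complex.normSq w)⁻¹ : ℝ) := by
    rw [div_eq_mul_inv, Complex.inv_def]; push_cast; ring
  rw [e, Complex.mul_re, Complex.ofReal_re, Complex.ofReal_im, mul_zero, sub_zero]
  exact mul_pos h (inv_pos.2 (Complex.normSq_pos.2 hw))

/-- In a closed half-plane `{Im(c·z) ≥ 0}` the angle between two vectors is the difference of the
arguments of the rotated vectors, provided it is not `π`. [folklore] -/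
theorem toReal_argDiff_eq_sub {c v w : ℂ} (hc : c ≠ 0) (hv : v ≠ 0) (hw : w ≠ 0)
    (hcv : 0 ≤ (c * v).im) (hcw : 0 ≤ (c * w).im)
    (hlt : |((Complex.arg v : Angle) - (Complex.arg w : Angle)).toReal| < π) :
    ((Complex.arg v : Angle) - (Complex.arg w : Angle)).toReal =
      Complex.arg (c * v) - Complex.arg (c * w) := by
  have e : (Complex.arg v : Angle) - (Complex.arg w : Angle) =
      ((Complex.arg (c * v) - Complex.arg (c * w) : ℝ) : Angle) := by
    rw [← argDiff_mul_mul hc hv hw, Angle.coe_sub]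
  have h1 := Complex.arg_nonneg_iff.2 hcv
  have h2 := Complex.arg_nonneg_iff.2 hcw
  have h3 := Complex.arg_le_pi (c * v)
  have h4 := Complex.arg_le_pi (c * w)
  rw [e] at hlt ⊢
  -- the representative lies in `[-π, π]`; the value `-π` is excluded by `hlt`
  rcases lt_or_eq_of_le (show -π ≤ Complex.arg (c * v) - Complex.arg (c * w) by linarith)
    with h | h
  · exact (Angle.toReal_coe_eq_self_iff.2 ⟨h, by linarith⟩)
  · exfalso
    rw [← h, Angle.coe_neg, Angle.neg_coe_pi, Angle.toReal_pi, abs_of_pos Real.pi_pos] at hlt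
    exact lt_irrefl _ hlt

/-! ### Swept angles in a half-plane -/

/-- **Swept angle in a half-plane.** If the nonzero vectors `u₀, …, u_N` all lie in the closed
half-plane `{Im(c·z) ≥ 0}` and consecutive ones are never opposite, the total angle swept by
`u₀ → u₁ → ⋯ → u_N` (sum of the principal values of the consecutive angles) is the difference of
the arguments of `c u_N` and `c u₀`. [folklore] -/
theorem sum_toReal_argDiff_eq {c : ℂ} (hc : c ≠ 0) (u : ℕ → ℂ) :
    ∀ N : ℕ, (∀ m ≤ N, u m ≠ 0) → (∀ m ≤ N, 0 ≤ (c * u m).im) →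
      (∀ m < N, |((Complex.arg (u (m + 1)) : Angle) - (Complex.arg (u m) : Angle)).toReal| < π) →
      ∑ m ∈ range N, ((Complex.arg (u (m + 1)) : Angle) - (Complex.arg (u m) : Angle)).toReal =
        Complex.arg (c * u N) - Complex.arg (c * u 0)
  | 0, _, _, _ => by simp
  | N + 1, hu, him, hlt => by
    rw [sum_range_succ, sum_toReal_argDiff_eq hc u N (fun m hm => hu m (by omega))
      (fun m hm => him m (by omega)) (fun m hm => hlt m (by omega)),
      toReal_argDiff_eq_sub hc (hu (N + 1) le_rfl) (hu N (by omega)) (him (N + 1) le_rfl)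
      (him N (by omega)) (hlt N (by omega))]
    ring

/-! ### The discrete Hopf identity for an open polygonal path -/

/-- **Discrete Hopf identity (Umlaufsatz for open polygons).** For points `q₀, …, q_{m+1}` such
that every segment `[q_k, q_{k+1}]` is seen from every other point `q_j` under an angle `< π/2`,
the total turning (sum of the exterior angles at `q₁, …, q_m`) equals the angle swept by the
secant into `q_{m+1}` (directions `q_{m+1} - q₀, …, q_{m+1} - q_m`) plus the angle swept by the
secant from `q₀` (directions `q₁ - q₀, …, q_{m+1} - q₀`). This is Hopf's deformation of the
tangent map through secant maps, discretised: every elementary quadrilateral / triangle of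
secant directions has zero circulation because its angles are `< π/2`. [folklore] -/
theorem hopf_open (q : ℕ → ℂ) : ∀ m : ℕ,
    (∀ k j : ℕ, k ≤ m → j ≤ m + 1 → j ≠ k → j ≠ k + 1 →
      0 < ((q (k + 1) - q j) * (starRingEnd ℂ) (q k - q j)).re) →
    ∑ j ∈ range m, ((Complex.arg (q (j + 2) - q (j + 1)) : Angle) -
        (Complex.arg (q (j + 1) - q j) : Angle)).toReal =
      ∑ i ∈ range m, ((Complex.arg (q (m + 1) - q (i + 1)) : Angle) -
          (Complex.arg (q (m + 1) - q i) : Angle)).toReal +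
        ∑ i ∈ range m, ((Complex.arg (q (i + 2) - q 0) : Angle) -
          (Complex.arg (q (i + 1) - q 0) : Angle)).toReal
  | 0, _ => by simp
  | m + 1, hsub => by
    -- rows of secants: X = into the old end `q_{m+1}`, Y = into the new end `q_{m+2}`,
    -- Z = the rungs between them, W = from the start `q₀`
    set X : ℕ → ℝ := fun i => ((Complex.arg (q (m + 1) - q (i + 1)) : Angle) -
      (Complex.arg (q (m + 1) - q i) : Angle)).toReal with hX
    set Y : ℕ → ℝ := fun i => ((Complex.arg (q (m + 2) - q (i + 1)) : Angle) -
      (Complex.arg (q (m + 2) - q i) : Angle)).toReal with hY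
    set Z : ℕ → ℝ := fun i => ((Complex.arg (q (m + 2) - q i) : Angle) -
      (Complex.arg (q (m + 1) - q i) : Angle)).toReal with hZ
    set W : ℕ → ℝ := fun i => ((Complex.arg (q (i + 2) - q 0) : Angle) -
      (Complex.arg (q (i + 1) - q 0) : Angle)).toReal with hW
    have ih := hopf_open q m (fun k j hk hj h1 h2 => hsub k j (by omega) (by omega) h1 h2)
    -- the subtended-angle bounds
    have hre : ∀ v w : ℂ, ((-v) * (starRingEnd ℂ) (-w)).re = (v * (starRingEnd ℂ) w).re := by
      intro v w; simp
    have bX : ∀ i < m, |X i| < π / 2 := by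
      intro i hi
      apply abs_toReal_argDiff_lt
      have := hsub i (m + 1) (by omega) (by omega) (by omega) (by omega)
      rwa [← hre, neg_sub, neg_sub] at this
    have bY : ∀ i ≤ m, |Y i| < π / 2 := by
      intro i hi
      apply abs_toReal_argDiff_lt
      have := hsub i (m + 2) (by omega) (by omega) (by omega) (by omega)
      rwa [← hre, neg_sub, neg_sub] at this
    have bZ : ∀ i ≤ m, |Z i| < π / 2 := by
      intro i hi
      apply abs_toReal_argDiff_lt
      exact hsub (m + 1) i (by omega) (by omega) (by omega) (by omega)
    -- plaquettes
    have plaq : ∀ i < m, X i + Z (i + 1) = Y i + Z i := by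
      intro i hi
      apply toReal_add_eq_toReal_add _ (bX i hi) (bZ (i + 1) (by omega)) (bY i (by omega))
        (bZ i (by omega))
      abel
    have hsumX : ∑ i ∈ range m, X i + (Z m - Z 0) = ∑ i ∈ range m, Y i := by
      rw [← Finset.sum_range_sub, ← sum_add_distrib]
      refine sum_congr rfl fun i hi => ?_
      rw [mem_range] at hi
      linarith [plaq i hi]
    -- the corner triangle
    have corner : Y m + Z m = ((Complex.arg (q (m + 2) - q (m + 1)) : Angle) -
        (Complex.arg (q (m + 1) - q m) : Angle)).toReal := by
      rw [← toReal_add_of_lt (bY m le_rfl) (bZ m le_rfl), argDiff_add_argDiff]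
    -- assemble
    have e1 : ∀ i, ((Complex.arg (q (m + 1 + 1) - q (i + 1)) : Angle) -
        (Complex.arg (q (m + 1 + 1) - q i) : Angle)).toReal = Y i := fun i => rfl
    have e2 : ((Complex.arg (q (m + 2) - q 0) : Angle) -
        (Complex.arg (q (m + 1) - q 0) : Angle)).toReal = Z 0 := rfl
    rw [sum_range_succ, ih, sum_range_succ W, sum_range_succ]
    simp only [e1]
    show ∑ i ∈ range m, X i + ∑ i ∈ range m, W i + ((Complex.arg (q (m + 2) - q (m + 1)) : Angle) -
          (Complex.arg (q (m + 1) - q m) : Angle)).toReal =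
      ∑ i ∈ range m, Y i + Y m + (∑ i ∈ range m, W i + ((Complex.arg (q (m + 2) - q 0) : Angle) -
          (Complex.arg (q (m + 1) - q 0) : Angle)).toReal)
    rw [e2, ← corner, ← hsumX]
    ring

end Hopf

namespace HV

open Real Hopf

/-! ### The embedded honeycomb lattice: coordinates of `emb` -/

/-- `Re ω = 1/2`. [folklore] -/
theorem omg_re : omg.re = 1 / 2 := by
  rw [omg, Complex.exp_ofReal_mul_I_re, Real.cos_pi_div_three]

/-- `Im ω = √3/2`. [folklore] -/
theorem omg_im : omg.im = Real.sqrt 3 / 2 := by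
  rw [omg, Complex.exp_ofReal_mul_I_im, Real.sin_pi_div_three]

/-- Real part of `emb (a, b) = a + b ω`. [folklore] -/
theorem emb_re (p : ℤ × ℤ) : (emb p).re = p.1 + p.2 / 2 := by
  simp [emb, omg_re, omg_im]; ring

/-- Imaginary part of `emb (a, b) = a + b ω`. [folklore] -/
theorem emb_im (p : ℤ × ℤ) : (emb p).im = p.2 * (Real.sqrt 3 / 2) := by
  simp [emb, omg_re, omg_im]

/-- `emb` is injective. [folklore] -/
theorem emb_injective : Function.Injective emb := by
  intro p q h
  have h2 := congrArg Complex.im h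
  rw [emb_im, emb_im] at h2
  have hs : (0 : ℝ) < Real.sqrt 3 / 2 := by positivity
  have e2 : (p.2 : ℝ) = q.2 := by nlinarith
  have h1 := congrArg Complex.re h
  rw [emb_re, emb_re] at h1
  have e2' : p.2 = q.2 := by exact_mod_cast e2
  have e1 : (p.1 : ℝ) = q.1 := by rw [e2] at h1; linarith
  exact Prod.ext (by exact_mod_cast e1) e2'

/-- `emb p = 0 ↔ p = 0`. [folklore] -/
theorem emb_eq_zero_iff {p : ℤ × ℤ} : emb p = 0 ↔ p = 0 := by
  constructor
  · intro h
    apply emb_injective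
    rw [h]; simp [emb]
  · rintro rfl; simp [emb]

/-- The real inner product of two embedded lattice vectors in terms of the Eisenstein norms
`a² + ab + b² = |a + bω|²` (polarisation). [folklore] -/
theorem emb_mul_conj_re (X Y : ℤ × ℤ) :
    (emb X * (starRingEnd ℂ) (emb Y)).re =
      ((X.1 ^ 2 + X.1 * X.2 + X.2 ^ 2) + (Y.1 ^ 2 + Y.1 * Y.2 + Y.2 ^ 2) -
        ((X - Y).1 ^ 2 + (X - Y).1 * (X - Y).2 + (X - Y).2 ^ 2) : ℤ) / 2 := by
  rw [Complex.mul_re, Complex.conj_re, Complex.conj_im, emb_re, emb_re, emb_im, emb_im]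
  simp only [Prod.fst_sub, Prod.snd_sub]
  push_cast
  have h3 : Real.sqrt 3 ^ 2 = 3 := Real.sq_sqrt (by norm_num)
  nlinarith [h3]

/-- `pos` is injective. [folklore] -/
theorem pos_injective : Function.Injective pos := by
  rintro ⟨a, b, c⟩ ⟨a', b', c'⟩ h
  cases c <;> cases c' <;> simp [pos, Prod.mk.injEq] at h ⊢ <;> omega

/-- A nonzero integer has square at least one. [folklore] -/
private theorem one_le_sq_of_ne_zero {p : ℤ} (h : p ≠ 0) : 1 ≤ p ^ 2 := by
  rcases lt_trichotomy p 0 with hp | hp | hp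
  · nlinarith
  · exact absurd hp h
  · nlinarith

/-- Two distinct vertices of `ℍ` are at distance at least one edge length (`√3` in the frame
`pos`): the Eisenstein norm of the difference of their positions is at least `3`. [folklore] -/
theorem three_le_enorm_pos_sub {u w : HV} (h : u ≠ w) :
    3 ≤ (pos u - pos w).1 ^ 2 + (pos u - pos w).1 * (pos u - pos w).2 + (pos u - pos w).2 ^ 2 := by
  obtain ⟨a, b, c⟩ := u
  obtain ⟨a', b', c'⟩ := w
  -- same type: the difference is `3(p, r)` with `(p, r) ≠ 0`
  have key1 : ∀ p r : ℤ, (p, r) ≠ (0, 0) →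
      3 ≤ (3 * p) ^ 2 + (3 * p) * (3 * r) + (3 * r) ^ 2 := by
    intro p r hpr
    have : 1 ≤ p ^ 2 + r ^ 2 := by
      by_cases hp : p = 0
      · subst hp
        have hr : r ≠ 0 := fun hr => hpr (by rw [hr])
        nlinarith [one_le_sq_of_ne_zero hr]
      · nlinarith [one_le_sq_of_ne_zero hp, sq_nonneg r]
    nlinarith [sq_nonneg (p + r)]
  -- different types: the difference is `3(p, r) + (1, 1)`
  have key2 : ∀ p r : ℤ, 3 ≤ (3 * p + 1) ^ 2 + (3 * p + 1) * (3 * r + 1) + (3 * r + 1) ^ 2 := by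
    intro p r
    by_cases hpr : p = 0 ∧ r = 0
    · obtain ⟨rfl, rfl⟩ := hpr; norm_num
    · have : 1 ≤ p ^ 2 + r ^ 2 := by
        by_cases hp : p = 0
        · subst hp
          have hr : r ≠ 0 := fun hr => hpr ⟨rfl, hr⟩
          nlinarith [one_le_sq_of_ne_zero hr]
        · nlinarith [one_le_sq_of_ne_zero hp, sq_nonneg r]
      nlinarith [sq_nonneg (p + r + 1)]
  cases c <;> cases c'
  · have hne : (a - a', b - b') ≠ (0, 0) := by
      intro e; apply h; simp only [Prod.mk.injEq] at e; ext <;> simp <;> omega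
    have := key1 _ _ hne
    convert this using 1; simp [pos]; ring
  · have := key2 (a' - a) (b' - b)
    convert this using 1; simp [pos]; ring
  · have := key2 (a - a') (b - b')
    convert this using 1; simp [pos]; ring
  · have hne : (a - a', b - b') ≠ (0, 0) := by
      intro e; apply h; simp only [Prod.mk.injEq] at e; ext <;> simp <;> omega
    have := key1 _ _ hne
    convert this using 1; simp [pos]; ring

/-- An edge of `ℍ` has Eisenstein norm `3`. [folklore] -/
theorem enorm_pos_sub_of_adj {u v : HV} (h : hvGraph.Adj u v) :
    (pos v - pos u).1 ^ 2 + (pos v - pos u).1 * (pos v - pos u).2 + (pos v - pos u).2 ^ 2 = 3 := by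
  obtain ⟨a, b, c⟩ := u
  obtain ⟨a', b', c'⟩ := v
  cases c <;> cases c' <;> simp only [hvGraph_adj, AdjRel] at h <;> simp at h <;>
    rcases h with ⟨rfl, rfl⟩ | ⟨rfl, rfl⟩ | ⟨rfl, rfl⟩ <;> simp [pos] <;> ring

/-- **The subtended-angle bound.** An edge `{u, v}` of the embedded honeycomb lattice is seen
from any third vertex `w` under an angle `< π/2`: the inner product of `v - w` and `u - w` is
positive (both have squared length `≥ 3 = |v - u|²`). [folklore] -/
theorem subtended_pos {u v w : HV} (h : hvGraph.Adj u v) (hu : w ≠ u) (hv : w ≠ v) :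
    0 < (emb (pos v - pos w) * (starRingEnd ℂ) (emb (pos u - pos w))).re := by
  rw [emb_mul_conj_re]
  have h1 := three_le_enorm_pos_sub (Ne.symm hv)
  have h2 := three_le_enorm_pos_sub (Ne.symm hu)
  have h3 := enorm_pos_sub_of_adj h
  rw [show pos v - pos w - (pos u - pos w) = pos v - pos u by abel]
  have : (3 : ℝ) ≤ ((pos v - pos w).1 ^ 2 + (pos v - pos w).1 * (pos v - pos w).2 +
      (pos v - pos w).2 ^ 2 + ((pos u - pos w).1 ^ 2 + (pos u - pos w).1 * (pos u - pos w).2 +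
      (pos u - pos w).2 ^ 2) - ((pos v - pos u).1 ^ 2 + (pos v - pos u).1 * (pos v - pos u).2 +
      (pos v - pos u).2 ^ 2) : ℤ) := by
    rw [h3]; exact_mod_cast (by omega : (3 : ℤ) ≤ _)
  linarith

/-- The subtended-angle bound, with both vectors reversed. [folklore] -/
theorem subtended_pos' {u v w : HV} (h : hvGraph.Adj u v) (hu : w ≠ u) (hv : w ≠ v) :
    0 < (emb (pos w - pos v) * (starRingEnd ℂ) (emb (pos w - pos u))).re := by
  rw [show pos w - pos v = -(pos v - pos w) by abel, show pos w - pos u = -(pos u - pos w) by abel,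
    emb_neg, emb_neg, map_neg, neg_mul_neg]
  exact subtended_pos h hu hv

end HV

end Literature.Probability.RandomPlanarGeometry.SAW
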